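import Literature.Computability.QuantumComplexity.PhaseQueryAccept
import Literature.Computability.QuantumComplexity.CoinFamilyKernel
import Literature.Computability.Cryptography.KitaevPhaseEstimationCircuit
import HarnessLib

/-!
# Phase-query families, VII: the full output law of the family and single-query specifications

Seventh, generic file of the construction `PhaseQueryOps/Layout/State/Accept/Uniform/BQP.lean`
(the uniform Clifford+`T` family `PhaseQuery.family P` of a phase machine `P` with specification
`S`: three copies of the padded Forrelation circuit `H^{⊗W} U_{f_k} ⋯ U_{f_1} H^{⊗W}` of
Aaronson–Ambainis, §3.2, Fig. 2, followed by a zero test on wire `0`). `PhaseQueryAccept.lean`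
computes the ACCEPTANCE probability only; a client that SAMPLES the query register — Fourier
sampling in the sense of Bernstein–Vazirani and Simon: run `H^{⊗W} U_f H^{⊗W}` on `|0^W⟩` and
measure all wires (Simon 1997, §3.1; Nielsen–Chuang 2010, §1.4.4 and Box 5.4) — needs the whole
output law. This file provides it, with no new construction:

* `clEval_post_apply_E` — the zero test (`postC`) writes only on wire `0` and behind the query
  registers (`RevClean.le_target_of_mem_cleanOps`, `postC_target`), so on `N ≥ 1` input wires it
  leaves the three query registers unchanged;
* **`kernelProb_family_regs`** — for every property `T` of the contents of the three query
  registers (read off the measured string at the query wires `qW c t`),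
  `Pr[T] = ∑_v (∏_c |phiFin (v c)|²) [T v]`: the product state `⊗_c phiFin` after the layers
  (`middle_mulVec`), the permutation of the Born weights by the zero test
  (`sum_ite_normSq_mulVec_of_perm`) and the product rule (`sum_normSq_prodState_mul`), exactly as in
  `acceptProb_bigCirc`; `kernelProb_family_reg0` — the marginal of the first register,
  `Pr[T] = ∑_v |phiFin v|² [T v]`;
* **single-query specifications** (`OnePhaseAt`: two active Hadamard layers, `W ≤ Wq` active
  wires, no phase but in layer `1`): `phiFin = Hact · Dg 1 · Hact |0^{Wq}⟩` (`phiFin_eq_of_onePhaseAt`,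
  `Hact` the Hadamard gates on the active wires `actWires`), and its amplitudes
  (`phiFin_apply_of_onePhaseAt`): zero unless the inactive wires read `0`, and then the Fourier
  coefficient `2^{-W} ∑_{u ∈ {0,1}^W} (-1)^{f(u)} (-1)^{u·v}` (`padW`, `chiW`), by the signed
  Hadamard-layer lemma `hadamards_mulVec_basisState_signed` of `KitaevPhaseEstimationCircuit.lean`.

## References

* S. Aaronson, A. Ambainis, *Forrelation: a problem that optimally separates quantum from
  classical computing*, SIAM J. Comput. 47 (2018), §3.2 (Fig. 2) [AaronsonAmbainis2018].
* D. R. Simon, *On the power of quantum computation*, SIAM J. Comput. 26 (1997) 1474–1483, §3.1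
  (Fourier sampling twice) [Simon1997].
* M. A. Nielsen, I. L. Chuang, *Quantum Computation and Quantum Information*, CUP 2010, §1.4.4
  (eq. (1.50): `H^{⊗n}|x⟩ = 2^{-n/2} ∑_z (-1)^{x·z}|z⟩`), §2.2.5 (Born rule), §2.2.8 (product
  states) [NielsenChuang2010].
-/

noncomputable section

namespace Literature.Computability.QuantumComplexity

open _root_.Computability Complexity Cryptography Matrix Finset RevSim RevClean RazTalMachine Turing
open Cryptography.Kitaev1995 (hSign hadamards_mulVec_basisState_signed invSqrt2_pow_mul_pow)

namespace PhaseQuery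

open scoped Classical

variable (P : Params) (S : Spec P) (x : List Bool) (A : Language Bool)

local notation "N" => x.length

/-! ### The zero test does not touch the query registers -/

section PostRegs

/-- Every operation of the clean block `cleanOps e M n₀ v` writes on a wire `≥ n₀` (behind the
data wires). [folklore] -/
theorem _root_.Literature.Computability.QuantumComplexity.RevClean.le_target_of_mem_cleanOps
    {e : ℕ} {M : TM2ComputableAux Bool Bool} {n₀ : ℕ} {v : List Bool} {op : ClOp ℕ}
    (hop : op ∈ cleanOps e M n₀ v) : n₀ ≤ op.target := by
  simp only [cleanOps, List.mem_append, List.mem_reverse] at hop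
  have hnots : op ∈ notsV n₀ v → n₀ ≤ op.target := fun h => by
    simp only [notsV, List.mem_map, List.mem_filter, List.mem_range] at h
    obtain ⟨i, -, rfl⟩ := h
    exact Nat.le_add_right _ _
  have hcomp : op ∈ comp e M (n₀ + v.length) → n₀ ≤ op.target := fun h =>
    (Nat.le_add_right _ _).trans (le_target_of_mem_comp h)
  rcases hop with h | h | h | h | h
  · exact hnots h
  · exact hcomp h
  · obtain ⟨p, hp, rfl⟩ := mem_copyOps.1 h
    exact ((Nat.le_add_right _ _).trans (le_NN (e := e) (M := M) _)).trans (outPairs_target_bounds hp).1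
  · exact hcomp h
  · exact hnots h

/-- Every operation of the zero test writes on wire `0` or behind the query registers. [folklore] -/
theorem postC_target (op : ClOp ℕ) (hop : op ∈ postC P N) : op.target = 0 ∨ N + 3 * Wq P N ≤ op.target := by
  have hblk : op ∈ blkC P N → N + 3 * Wq P N ≤ op.target := fun h => by
    have := RevClean.le_target_of_mem_cleanOps h
    unfold D at this; omega
  have hmw : ∀ i, N + 3 * Wq P N ≤ mw P N i := fun i => by unfold mw; omega
  have hoW : N + 3 * Wq P N ≤ oW P N := by
    have := D_le_Wblk P N; unfold oW; unfold D at this; omega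
  simp only [postC, List.mem_append, List.mem_cons, List.not_mem_nil, or_false] at hop
  rcases hop with ((((h | h) | h) | h) | h) | h
  · rcases h with rfl | rfl <;> exact Or.inr (hmw _)
  · exact Or.inr (hblk h)
  · rcases h with rfl | rfl <;> exact Or.inr hoW
  · exact Or.inr (hblk h)
  · rcases h with rfl | rfl <;> exact Or.inr (hmw _)
  · rcases h with rfl | rfl | rfl
    · exact Or.inl rfl
    · exact Or.inr hoW
    · exact Or.inl rfl

/-- **The zero test leaves the query registers unchanged** (on `N ≥ 1` input wires, so that wire
`0`, onto which the answer flag is swapped, is an input wire). [folklore] -/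
theorem clEval_post_apply_E (hN : 1 ≤ N) (z : QReg (TW P N)) (c : Fin 3) (t : Fin (Wq P N)) :
    clEval ((postC P N).map (ClOp.map (foW P N))) z (E P x c t) = z (E P x c t) := by
  refine clEval_apply_of_forall_target_ne _ _ fun op hop heq => ?_
  obtain ⟨op', hop', rfl⟩ := List.mem_map.1 hop
  rw [ClOp.target_map] at heq
  have hlt : op'.target < TW P N := postC_lt P N op' hop' _ ((mem_wiresOf op' op'.target).2 (Or.inl rfl))
  have hval : op'.target = qW P N c t := by
    have h1 := congrArg Fin.val heq
    rw [foW, val_finOf_of_lt (TW_pos P N) hlt] at h1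
    exact h1
  have h1 := qW_lt P N c.isLt t.isLt
  have h2 := N_le_qW P N c t
  rcases postC_target P x op' hop' with h | h <;> omega

/-- The same, for all registers at once: the blocks of the permuted label are the blocks of the
label. [folklore] -/
theorem comp_E_clEval_post (hN : 1 ≤ N) (z : QReg (TW P N)) (c : Fin 3) :
    clEval ((postC P N).map (ClOp.map (foW P N))) z ∘ E P x c = z ∘ E P x c :=
  funext fun t => clEval_post_apply_E P x hN z c t

end PostRegs

/-! ### The output law of the family -/

section Kernel

/-- **The full output law of a phase-query family.** For every property `T` of the contents of
the three query registers, the probability that the measured output string `w` of the family on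
input `x` (`|x| ≥ 1`) has register contents (read at the query wires `qW c t`) satisfying `T` is
the Born weight of `T` under the product of three copies of the final block state `phiFin`:
`Pr[T] = ∑_v (∏_c |phiFin (v c)|²) · [T v]` — the register holds the product state
`⊗_c phiFin` after the layers (`middle_mulVec`), the zero test permutes basis states without
touching the query wires (`comp_E_clEval_post`), and the Born weights of a product state form
the product distribution (`CircuitEmbedding.sum_normSq_prodState_mul`). (Nielsen–Chuang 2010,
§2.2.5 and §2.2.8; Aaronson–Ambainis 2018, §3.2: sampling the register of the Forrelation
circuit.) [cite: NielsenChuang2010, §2.2.5 and §2.2.8] -/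
theorem kernelProb_family_regs (hN : 1 ≤ N) (T : (Fin 3 → QReg (Wq P N)) → Prop) :
    (family P).kernelProb A x {w | T fun c t => w.getD (qW P N c t) false} =
      ∑ v : Fin 3 → QReg (Wq P N), (∏ c, ‖phiFin P S x A (v c)‖ ^ 2) * (if T v then 1 else 0) := by
  have hT := TW_pos P N
  have hsplit : (allOps P N).map (RtOp.map (foW P N)) =
      ((preC P N).map (ClOp.map (foW P N))).map RtOp.cl ++ ((layers P N ++ hLayer P N (Ly P N)).map (RtOp.map (foW P N)) ++
        ((postC P N).map (ClOp.map (foW P N))).map RtOp.cl) := by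
    simp [allOps, pre, post, List.map_map, Function.comp_def, RtOp.map]
  unfold QCircuitFamily.kernelProb QCircuitFamily.kernel
  rw [toReal_outputPMF_map_ofFn]
  show (∑ z : QReg (TW P N), if List.ofFn z ∈ {w | T fun c t => w.getD (qW P N c t) false} then
      ‖(bigCirc P N).runOn A (basisState (padInput x.get (anc P N))) z‖ ^ 2 else 0) = _
  simp only [Set.mem_setOf_eq, QCircuit.runOn]
  -- reading the registers of a measured label
  have hread : ∀ z : QReg (TW P N), (fun (c : Fin 3) (t : Fin (Wq P N)) => (List.ofFn z).getD (qW P N c t) false) =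
      fun c => z ∘ E P x c := by
    intro z; funext c t
    rw [List.getD_eq_getElem?_getD, List.getElem?_ofFn]
    have hlt : qW P N c t < TW P N := lt_TW_of_lt_D P N (qW_lt_D P N c.isLt t.isLt)
    simp [hlt]; rfl
  simp only [hread]
  unfold bigCirc
  rw [RtOp.compileList_congr hsplit _ (fun op hop => (wf_map_finOf_of hT (allOps_wf P N) (allOps_lt P N)) op (hsplit ▸ hop)),
    compileList_append_mulVec, compileList_append_mulVec, pre_mulVec P S x A, middle_mulVec P S x A]
  -- the zero test permutes the Born weights and keeps the registers
  have hperm := sum_ite_normSq_mulVec_of_perm (W := TW P N) ⟨_, post_injective P x⟩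
    (post_mulVec_basisState P x A (fun o ho => (wf_map_finOf_of hT (allOps_wf P N) (allOps_lt P N)) o
      (hsplit ▸ List.mem_append_right _ (List.mem_append_right _ ho))))
    (prodState (E P x) (fun _ => phiFin P S x A) (zPreF P S x)) (fun y => T fun c => y ∘ E P x c)
  rw [hperm]
  have hsupp : ∀ z, (if T (fun c => (⟨_, post_injective P x⟩ : QReg (TW P N) ↪ QReg (TW P N)) z ∘ E P x c) then
      ‖prodState (E P x) (fun _ => phiFin P S x A) (zPreF P S x) z‖ ^ 2 else 0) =
      ‖prodState (E P x) (fun _ => phiFin P S x A) (zPreF P S x) z‖ ^ 2 *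
        (if T (fun c => z ∘ E P x c) then (1 : ℝ) else 0) := by
    intro z
    rw [Function.Embedding.coeFn_mk]
    simp only [comp_E_clEval_post P x hN z]
    split <;> simp
  rw [Finset.sum_congr rfl fun z _ => hsupp z,
    sum_normSq_prodState_mul (blockDisjoint_E P x) _ _ (fun y => if T y then (1 : ℝ) else 0)]

end Kernel

/-! ### Single-query specifications: the final block state in closed form -/

section OnePhase

/-- The copy-`0` marginal of the output law: for a property `T` of the content of the first query
register, `Pr[T] = ∑_v |phiFin v|² [T v]`. [cite: NielsenChuang2010, §2.2.5 and §2.2.8] -/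
theorem kernelProb_family_reg0 (hN : 1 ≤ N) (T : QReg (Wq P N) → Prop) :
    (family P).kernelProb A x {w | T fun t => w.getD (qW P N 0 t) false} =
      ∑ v : QReg (Wq P N), ‖phiFin P S x A v‖ ^ 2 * (if T v then 1 else 0) := by
  have h := kernelProb_family_regs P S x A hN (fun v => T (v 0))
  have e : {w : List Bool | T fun t => w.getD (qW P N ((0 : Fin 3) : ℕ) t) false} =
      {w | T fun t => w.getD (qW P N 0 t) false} := rfl
  rw [e] at h
  rw [h]
  -- sum out the registers of copies `1` and `2`
  have hn : (∑ v : QReg (Wq P N), ‖phiFin P S x A v‖ ^ 2) = 1 := normSq_phiFin P S x A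
  set g : Fin 3 → QReg (Wq P N) → ℝ := fun c y => ‖phiFin P S x A y‖ ^ 2 * (if c = 0 then (if T y then 1 else 0) else 1) with hg
  have key : ∀ v : Fin 3 → QReg (Wq P N),
      (∏ c, ‖phiFin P S x A (v c)‖ ^ 2) * (if T (v 0) then (1 : ℝ) else 0) = ∏ c, g c (v c) := by
    intro v
    simp only [hg, Fin.prod_univ_three, Fin.isValue, ↓reduceIte, one_ne_zero, mul_one,
      show (2 : Fin 3) ≠ 0 from by decide]
    ring
  rw [Finset.sum_congr rfl fun v _ => key v]
  have := Finset.prod_univ_sum (fun _ : Fin 3 => (Finset.univ : Finset (QReg (Wq P N)))) g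
  rw [Fintype.piFinset_univ] at this
  rw [← this, Fin.prod_univ_three]
  simp only [hg, Fin.isValue, ↓reduceIte, one_ne_zero, mul_one, show (2 : Fin 3) ≠ 0 from by decide, hn]

/-- The list of **active query wires** `t < Wv x` of one register. [cite: AaronsonAmbainis2018, §3.2 (Fig. 2)] -/
def actWires : List (Fin (Wq P N)) := (List.finRange (Wq P N)).filter fun t => t.val < S.Wv x

/-- The active wires are distinct. [folklore] -/
theorem actWires_nodup : (actWires P S x).Nodup := (List.nodup_finRange _).filter _

/-- Membership in the active wires. [folklore] -/
theorem mem_actWires (t : Fin (Wq P N)) : t ∈ actWires P S x ↔ t.val < S.Wv x := by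
  simp [actWires, List.mem_finRange]

/-- **The Hadamard layer on the active wires.** [cite: AaronsonAmbainis2018, §3.2 (Fig. 2)] -/
def Hact : Matrix (QReg (Wq P N)) (QReg (Wq P N)) ℂ :=
  (⟨(actWires P S x).map hOn⟩ : QCircuit cliffordT (Wq P N)).toMatrix A

/-- An active Hadamard layer is the Hadamard gates on the active wires among `ts`. [folklore] -/
theorem hSel_of_lt {j : ℕ} (hj : j < S.Kv x) (ts : List (Fin (Wq P N))) :
    hSel P S x j ts = (ts.filter fun t => t.val < S.Wv x).map hOn := by
  induction ts with
  | nil => rfl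
  | cons t ts ih =>
    simp only [hSel, List.flatMap_cons] at ih ⊢
    rw [ih, List.filter_cons]
    by_cases ht : t.val < S.Wv x
    · simp [hj, ht]
    · simp [ht]

/-- An inactive Hadamard layer is empty. [folklore] -/
theorem hSel_of_le {j : ℕ} (hj : S.Kv x ≤ j) (ts : List (Fin (Wq P N))) : hSel P S x j ts = [] := by
  induction ts with
  | nil => rfl
  | cons t ts ih => simp only [hSel, List.flatMap_cons] at ih ⊢; rw [ih]; simp [not_lt.2 hj]

/-- Active layers are `Hact`. [folklore] -/
theorem Hm_of_lt {j : ℕ} (hj : j < S.Kv x) : Hm P S x A j = Hact P S x A := by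
  unfold Hm Hact actWires; rw [hSel_of_lt P S x hj]

/-- Inactive layers are the identity. [folklore] -/
theorem Hm_of_le {j : ℕ} (hj : S.Kv x ≤ j) : Hm P S x A j = 1 := by
  unfold Hm; rw [hSel_of_le P S x hj]; exact QCircuit.toMatrix_nil A

/-- A layer whose phase predicate is identically false is the identity. [folklore] -/
theorem Dg_eq_one {j : ℕ} (hPf : ∀ u, S.Pf x u j = false) : Dg P S x j = 1 := by
  unfold Dg
  have : sgnP P S x j = fun _ => 1 := funext fun y => by simp [sgnP, hPf]
  rw [this]; rfl

/-- **Single-query specifications.** On input `x` the specification answers two active Hadamard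
layers, at most `Wq` active wires, and no phase but in layer `1`: the padded Forrelation circuit is
then the `1`-fold circuit `H^{⊗W} U_f H^{⊗W}` (Deutsch–Jozsa / Fourier sampling shape).
[cite: AaronsonAmbainis2018, §3.2 (Fig. 2, k = 1)] -/
structure OnePhaseAt : Prop where
  /-- two active Hadamard layers -/
  hK : S.Kv x = 2
  /-- at least two layers are available -/
  hLy : 2 ≤ Ly P N
  /-- the active wires fit in the register -/
  hW : S.Wv x ≤ Wq P N
  /-- no phase outside layer `1` -/
  hPf : ∀ (u : List Bool) (j : ℕ), 2 ≤ j → S.Pf x u j = false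

variable {P S x}

/-- Under a single-query specification the block states from layer `2` on are
`Hact · Dg 1 · Hact |0^{Wq}⟩`. [cite: AaronsonAmbainis2018, §3.2 (Fig. 2, k = 1)] -/
theorem phi_eq_of_onePhaseAt (h : OnePhaseAt P S x) :
    ∀ j, 2 ≤ j → phi P S x A j = Hact P S x A *ᵥ (Dg P S x 1 *ᵥ (Hact P S x A *ᵥ basisState fun _ => false))
  | 0, hj => absurd hj (by norm_num)
  | 1, hj => absurd hj (by norm_num)
  | 2, _ => by
    show Dg P S x 2 *ᵥ (Hm P S x A 1 *ᵥ (Dg P S x 1 *ᵥ (Hm P S x A 0 *ᵥ basisState fun _ => false))) = _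
    rw [Dg_eq_one P S x (fun u => h.hPf u 2 le_rfl), Matrix.one_mulVec, Hm_of_lt P S x A (by rw [h.hK]; norm_num),
      Hm_of_lt P S x A (by rw [h.hK]; norm_num)]
  | j + 3, _ => by
    show Dg P S x (j + 3) *ᵥ (Hm P S x A (j + 2) *ᵥ phi P S x A (j + 2)) = _
    rw [Dg_eq_one P S x (fun u => h.hPf u (j + 3) (by omega)), Matrix.one_mulVec,
      Hm_of_le P S x A (by rw [h.hK]; omega), Matrix.one_mulVec, phi_eq_of_onePhaseAt h (j + 2) (by omega)]

/-- **The final block state of a single-query specification** is `Hact · Dg 1 · Hact |0^{Wq}⟩`.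
[cite: AaronsonAmbainis2018, §3.2 (Fig. 2, k = 1)] -/
theorem phiFin_eq_of_onePhaseAt (h : OnePhaseAt P S x) :
    phiFin P S x A = Hact P S x A *ᵥ (Dg P S x 1 *ᵥ (Hact P S x A *ᵥ basisState fun _ => false)) := by
  unfold phiFin
  rw [Hm_of_le P S x A (by rw [h.hK]; exact h.hLy), Matrix.one_mulVec, phi_eq_of_onePhaseAt A h _ h.hLy]

/-! ### The amplitudes of the final block state of a single-query specification -/

/-- `(range K).filter (· < W) = range W` for `W ≤ K`. [folklore] -/
theorem filter_lt_range {W K : ℕ} (h : W ≤ K) : (List.range K).filter (fun i => decide (i < W)) = List.range W := by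
  obtain ⟨d, rfl⟩ := Nat.exists_eq_add_of_le h
  rw [List.range_eq_range', List.range_eq_range', ← List.range'_append, List.filter_append,
    List.filter_eq_self.2 (fun i hi => by simp [List.mem_range'] at hi; simpa using hi),
    List.filter_eq_nil_iff.2 (fun i hi => by simp [List.mem_range'] at hi; simp; omega), List.append_nil]

/-- With `W ≤ Wq` active wires, the active wires are `0, …, W-1`. [folklore] -/
theorem actWires_eq_map_castLE (hW : S.Wv x ≤ Wq P N) :
    actWires P S x = (List.finRange (S.Wv x)).map (Fin.castLE hW) := by
  apply List.map_injective_iff.2 Fin.val_injective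
  rw [List.map_map, actWires, show (fun t : Fin (Wq P N) => decide (t.val < S.Wv x)) = (fun i : ℕ => decide (i < S.Wv x)) ∘ Fin.val from rfl,
    ← List.filter_map, List.map_coe_finRange_eq_range,
    show Fin.val ∘ Fin.castLE hW = (fun i : Fin (S.Wv x) => (i : ℕ)) from rfl, List.map_coe_finRange_eq_range]
  exact filter_lt_range hW

/-- The number of active wires. [folklore] -/
theorem length_actWires (hW : S.Wv x ≤ Wq P N) : (actWires P S x).length = S.Wv x := by
  rw [actWires_eq_map_castLE hW, List.length_map, List.length_finRange]

/-- **The active Hadamard layer on a basis state** (`H^{⊗W}|w⟩ = 2^{-W/2} ∑_z (-1)^{w·z}|z⟩` on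
the active wires, identity elsewhere). [cite: NielsenChuang2010, §1.4.4] -/
theorem Hact_mulVec_basisState (w : QReg (Wq P N)) :
    Hact P S x A *ᵥ basisState w = fun z =>
      if (∀ j, j ∉ actWires P S x → z j = w j) then invSqrt2 ^ (actWires P S x).length * hSign (actWires P S x) w z else 0 := by
  unfold Hact
  rw [QCircuit.toMatrix_eq_of_isOracleFree (fun g hg => by
      obtain ⟨i, -, rfl⟩ := List.mem_map.1 hg; exact hOn_isOracleFree i) A 0]
  exact hadamards_mulVec_basisState_signed _ (actWires_nodup P S x) w

/-- `hSign` against the zero label is `1`. [folklore] -/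
theorem hSign_zero_left {K : ℕ} (ws : List (Fin K)) (z : QReg K) : hSign ws (fun _ => false) z = 1 := by
  simp [hSign]

/-- **The content of the first `W` wires, extended by zeros** to a register content. [folklore] -/
def padW (K : ℕ) {W : ℕ} (u : Fin W → Bool) : QReg K := fun t => if h : t.val < W then u ⟨t.val, h⟩ else false

/-- `padW` on the first `W` wires. [folklore] -/
@[simp] theorem padW_castLE {W K : ℕ} (hW : W ≤ K) (u : Fin W → Bool) (i : Fin W) : padW K u (Fin.castLE hW i) = u i := by
  simp [padW, i.isLt]

/-- `padW` vanishes beyond the first `W` wires. [folklore] -/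
theorem padW_of_le {W K : ℕ} (u : Fin W → Bool) {t : Fin K} (ht : W ≤ t.val) : padW K u t = false := by
  simp [padW, not_lt.2 ht]

/-- `padW` is injective. [folklore] -/
theorem padW_injective {W K : ℕ} (hW : W ≤ K) : Function.Injective (padW K (W := W)) := fun u u' h => by
  funext i; have := congrFun h (Fin.castLE hW i); simpa using this

/-- **The sign `(-1)^{u · v}` on the first `W` wires.** [cite: NielsenChuang2010, §1.4.4 (eq. (1.50))] -/
def chiW {W K : ℕ} (hW : W ≤ K) (u : Fin W → Bool) (v : QReg K) : ℂ := ∏ i : Fin W, if u i && v (Fin.castLE hW i) then -1 else 1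

/-- `hSign` on the active wires against a padded content is `chiW`. [folklore] -/
theorem hSign_actWires_padW (hW : S.Wv x ≤ Wq P N) (u : Fin (S.Wv x) → Bool) (v : QReg (Wq P N)) :
    hSign (actWires P S x) (padW (Wq P N) u) v = chiW hW u v := by
  rw [hSign, actWires_eq_map_castLE hW, List.map_map, ← List.ofFn_eq_map, List.prod_ofFn]
  refine Finset.prod_congr rfl fun i _ => ?_
  simp [padW_castLE]

/-- **The amplitudes of the final block state of a single-query specification**: zero unless
the inactive wires read `0`, and then the Fourier coefficient
`2^{-W} ∑_{u ∈ {0,1}^W} (-1)^{f(u)} (-1)^{u·v}` of the phase signs of layer `1`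
(Deutsch–Jozsa / Bernstein–Vazirani / Simon "Fourier sampling" form of the `1`-fold Forrelation
circuit `H^{⊗W} U_f H^{⊗W} |0^W⟩`). [cite: AaronsonAmbainis2018, §3.2 (Fig. 2, k = 1)] [cite: NielsenChuang2010, §1.4.4] -/
theorem phiFin_apply_of_onePhaseAt (h : OnePhaseAt P S x) (v : QReg (Wq P N)) :
    phiFin P S x A v =
      if (∀ t : Fin (Wq P N), S.Wv x ≤ t.val → v t = false) then
        (1 / 2 : ℂ) ^ S.Wv x * ∑ u : Fin (S.Wv x) → Bool, sgnP P S x 1 (padW (Wq P N) u) * chiW h.hW u v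
      else 0 := by
  have hWl := length_actWires (P := P) (S := S) (x := x) h.hW
  have hoff : ∀ z : QReg (Wq P N), (∀ j, j ∉ actWires P S x → z j = false) ↔ (∀ t : Fin (Wq P N), S.Wv x ≤ t.val → z t = false) := by
    intro z
    simp only [mem_actWires, not_lt]
  rw [phiFin_eq_of_onePhaseAt A h]
  -- the state before the last layer
  have hψ : Dg P S x 1 *ᵥ (Hact P S x A *ᵥ basisState fun _ => false) = fun u =>
      if (∀ t : Fin (Wq P N), S.Wv x ≤ t.val → u t = false) then sgnP P S x 1 u * invSqrt2 ^ S.Wv x else 0 := by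
    rw [Dg_mulVec, Hact_mulVec_basisState]
    funext u
    simp only [hWl, ← hoff]
    split_ifs <;> simp [hSign_zero_left]
  rw [hψ]
  -- the last layer, entrywise
  change (∑ u, Hact P S x A v u * _) = _
  have hcol : ∀ u, Hact P S x A v u = (Hact P S x A *ᵥ basisState u) v := fun u => by rw [mulVec_basisState]
  simp only [hcol, Hact_mulVec_basisState, hWl]
  by_cases hv : ∀ t : Fin (Wq P N), S.Wv x ≤ t.val → v t = false
  · rw [if_pos hv]
    -- only the labels `u` vanishing off the active wires contribute, and for them `v ≡ u` off them
    have hterm : ∀ u : QReg (Wq P N),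
        (if (∀ j, j ∉ actWires P S x → v j = u j) then invSqrt2 ^ S.Wv x * hSign (actWires P S x) u v else 0) *
          (if (∀ t : Fin (Wq P N), S.Wv x ≤ t.val → u t = false) then sgnP P S x 1 u * invSqrt2 ^ S.Wv x else 0) =
        if (∀ t : Fin (Wq P N), S.Wv x ≤ t.val → u t = false) then
          (1 / 2 : ℂ) ^ S.Wv x * (sgnP P S x 1 u * hSign (actWires P S x) u v) else 0 := by
      intro u
      by_cases hu : ∀ t : Fin (Wq P N), S.Wv x ≤ t.val → u t = false
      · have hvu : ∀ j, j ∉ actWires P S x → v j = u j := fun j hj => by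
          rw [mem_actWires, not_lt] at hj; rw [hv j hj, hu j hj]
        rw [if_pos hvu, if_pos hu, if_pos hu, ← invSqrt2_pow_mul_pow]
        ring
      · rw [if_neg hu, if_neg hu, mul_zero]
    rw [Finset.sum_congr rfl fun u _ => hterm u, ← Finset.sum_filter, Finset.mul_sum]
    -- re-index the labels vanishing off the active wires by their active part
    symm
    refine Finset.sum_nbij' (padW (Wq P N)) (fun u i => u (Fin.castLE h.hW i)) (fun u _ => ?_) (fun u hu => Finset.mem_univ _)
      (fun u _ => ?_) (fun u hu => ?_) (fun u _ => ?_)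
    · exact Finset.mem_filter.2 ⟨Finset.mem_univ _, fun t ht => padW_of_le u ht⟩
    · funext i; simp
    · funext t
      by_cases ht : t.val < S.Wv x
      · simp only [padW, ht, ↓reduceDIte]; rfl
      · rw [padW_of_le _ (not_lt.1 ht), (Finset.mem_filter.1 hu).2 t (not_lt.1 ht)]
    · rw [hSign_actWires_padW h.hW]
  · rw [if_neg hv]
    refine Finset.sum_eq_zero fun u _ => ?_
    by_cases hu : ∀ t : Fin (Wq P N), S.Wv x ≤ t.val → u t = false
    · have hvu : ¬ ∀ j, j ∉ actWires P S x → v j = u j := fun hvu => hv fun t ht => by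
        rw [hvu t (by rw [mem_actWires, not_lt]; exact ht), hu t ht]
      rw [if_neg hvu, zero_mul]
    · rw [if_neg hu, mul_zero]

/-- The register content of a padded active content, as a list: the active content followed by
zeros. [folklore] -/
theorem ofFn_padW {W K : ℕ} (hW : W ≤ K) (u : Fin W → Bool) :
    List.ofFn (padW K u) = List.ofFn u ++ List.replicate (K - W) false := by
  apply List.ext_getElem
  · simp; omega
  · intro i h₁ h₂
    rw [List.getElem_ofFn]
    by_cases hi : i < W
    · rw [List.getElem_append_left (by simpa using hi), List.getElem_ofFn]
      simp [padW, hi]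
    · rw [List.getElem_append_right (by simpa using hi), List.getElem_replicate]
      simp [padW, hi]

/-- The query wires of the first register are the wires `N, …, N + Wq - 1`. [folklore] -/
theorem qW_zero (K t : ℕ) : qW P K 0 t = K + t := by simp [qW]

end OnePhase





end PhaseQuery

end Literature.Computability.QuantumComplexity
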